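import Mathlib
import Summits.Parity.BatemanHorn.Theorems.IsogenyRedeiSplitBlockJacobiRootCountFourier
import Summits.Parity.BatemanHorn.Theorems.IsogenyRedeiSplitBlockJacobiSmoothCutoff
import Summits.Parity.BatemanHorn.Theorems.IsogenyRedeiSplitBlockJacobiAbel
import Summits.Parity.BatemanHorn.Theorems.IsogenyRedeiSplitBlockJacobiVariation
import HarnessLib

/-!
# The bound for one cell (helper toward `stub_poissonReduction`, line `cofactor-root-discrepancy`,
crux `SplitBlockJacobi`, stmt-Parity-11583)

For a rectangle `(a, a'] × (b, b']` of dyadic type (`a' ≤ 2a`, `b' ≤ 2b`) and the smoothed root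
counts `A^w_q = Σ_{t ≤ x, q ∣ t²+1} w(t)` (`w` = the discrete cutoff of
`…SmoothCutoff`, `W = Σ_t w(t)`), we bound

`|Σ_{(Q,Q′) ∈ rect, Q ≡ Q′ ≡ 1 (4) primes} (Q|Q′) (A^w_{QQ′} − 4W/(QQ′))|`
`≤ 2H · Bd · 4W(1 + 3πHx/(ab))²/(ab) + #pairs · 4 (a′b′/(2H))^{k+1}/L^k`,

where `Bd` bounds every twisted root Weyl sum `T_h((a,m]×(b,n])`, `0 < |h| ≤ H` (the line's
`TierWeylBound`, taken here as a HYPOTHESIS for this rectangle).  Proof: the exact finite Fourier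
expansion (`sum_filter_dvd_sub_main_eq_fourier`, `ρ(QQ′) = 4`), the frequencies `0 < |h| ≤ H`
by two-dimensional Abel summation (`norm_sum_sum_mul_le_abel2`, `variation_G_le`), the
frequencies `|h| > H` by the decay of `ŵ` (`norm_cutoff_fourier_le`) and `|S(h, QQ′)| ≤ 4`.
Diagonal terms `Q = Q′` vanish since `(Q|Q) = 0`.
-/

noncomputable section

open Finset

namespace Summit.Parity.BatemanHorn.Cruxes.SplitBlockJacobi.CofactorRootDiscrepancy.Poisson

/-- The cutoff polynomial `(Σ_{M < s ≤ N} X^s) · (Σ_{j < L} X^j)^k ∈ ℕ[X]` (local notation). -/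
local notation3 "cutoffPoly[" M ", " N ", " L ", " k "]" =>
  ((∑ s ∈ Finset.Ioc M N, (Polynomial.X : Polynomial ℕ) ^ s) *
    (∑ j ∈ Finset.range L, (Polynomial.X : Polynomial ℕ) ^ j) ^ k)

/-- The weight `G_h(q) = (1/q) Σ_{1 ≤ t ≤ x} w(t) e(ht/q)` (local notation; `q : ℕ`). -/
local notation3 (prettyPrint := false) "Gw[" w ", " x ", " h "](" q ")" =>
  ((1 / ((q : ℕ) : ℂ)) * ∑ t ∈ Finset.Icc 1 x, ((w t : ℝ) : ℂ) *
    Complex.exp (2 * Real.pi * Complex.I * ((h : ℤ) : ℂ) * ((t : ℕ) : ℂ) / ((q : ℕ) : ℂ)))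

/-- The root Weyl sum `S(h, q)` (local notation; literally the skeleton's `rootWeylSum h q`). -/
local notation3 (prettyPrint := false) "rWS[" h "](" q ")" =>
  (∑ ν ∈ (Finset.range (q : ℕ)).filter (fun ν : ℕ => (q : ℕ) ∣ ν ^ 2 + 1),
    Complex.exp (2 * Real.pi * Complex.I * ((h : ℤ) : ℂ) * ((ν : ℕ) : ℂ) / ((q : ℕ) : ℂ)))

/-- The twisted root Weyl sum over `(a, m] × (b, n]` (local notation; literally the skeleton's
`twistedSum h a m b n`). -/
local notation3 (prettyPrint := false) "tS[" h "](" a ", " m ", " b ", " n ")" =>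
  (∑ Q ∈ (Finset.Ioc (a : ℕ) m).filter (fun Q : ℕ => Q.Prime ∧ Q % 4 = 1),
    ∑ Q' ∈ (Finset.Ioc (b : ℕ) n).filter (fun Q' : ℕ => Q'.Prime ∧ Q' % 4 = 1),
      ((jacobiSym (Q : ℤ) Q' : ℤ) : ℂ) * rWS[h](Q * Q'))

/-! ### Small facts -/

/-- `(Q|Q) = 0` for a prime `Q`. -/
theorem jacobiSym_self_prime {Q : ℕ} (hQ : Q.Prime) : jacobiSym (Q : ℤ) Q = 0 := by
  rw [jacobiSym.eq_zero_iff]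
  refine ⟨hQ.ne_zero, ?_⟩
  rw [Int.gcd_natCast_natCast, Nat.gcd_self]
  exact hQ.one_lt.ne'

/-- `|(Q|Q′)| ≤ 1`. -/
theorem norm_jacobiSym_le_one (Q Q' : ℕ) : ‖((jacobiSym (Q : ℤ) Q' : ℤ) : ℂ)‖ ≤ 1 := by
  rcases jacobiSym.trichotomy (Q : ℤ) Q' with h | h | h <;> rw [h] <;> simp

/-- `|(Q|Q′)| ≤ 1` (real version). -/
theorem abs_jacobiSym_le_one (Q Q' : ℕ) : |(jacobiSym (Q : ℤ) Q' : ℝ)| ≤ 1 := by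
  rcases jacobiSym.trichotomy (Q : ℤ) Q' with h | h | h <;> rw [h] <;> simp

/-- `#{h : 0 < |h| ≤ H} = 2H`. -/
theorem card_Icc_filter_ne_zero (H : ℕ) :
    ((Finset.Icc (-(H : ℤ)) (H : ℤ)).filter (fun h : ℤ => h ≠ 0)).card = 2 * H := by
  rw [Finset.filter_ne', Finset.card_erase_of_mem (by simp), Int.card_Icc]
  omega

/-- Membership in the symmetric frequency range: `0 < |h|` and `2|h| ≤ q`. -/
theorem two_mul_abs_le_of_mem {q : ℕ} {h : ℤ}
    (hh : h ∈ (Finset.Icc (-((q / 2 : ℕ) : ℤ)) ((q / 2 : ℕ) : ℤ)).filter (fun h : ℤ => h ≠ 0)) :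
    h ≠ 0 ∧ 2 * |(h : ℝ)| ≤ q := by
  rw [Finset.mem_filter, Finset.mem_Icc] at hh
  refine ⟨hh.2, ?_⟩
  have h1 : |h| ≤ ((q / 2 : ℕ) : ℤ) := abs_le.mpr hh.1
  have h2 : 2 * (q / 2) ≤ q := Nat.mul_div_le q 2
  have h3 : (2 : ℤ) * |h| ≤ q := by omega
  have h4 : ((2 * |h| : ℤ) : ℝ) ≤ ((q : ℤ) : ℝ) := by exact_mod_cast h3
  push_cast at h4
  exact h4

/-! ### Rectangle sums of the kernel are twisted sums -/

/-- The anchored rectangle sums of the kernel `f_h(Q,Q′) = [Q][Q′](Q|Q′)S(h,QQ′)` are the twisted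
root Weyl sums. -/
theorem sum_Ioc_Ioc_kernel_eq (h : ℤ) (a m b n : ℕ) :
    ∑ Q ∈ Finset.Ioc a m, ∑ Q' ∈ Finset.Ioc b n,
        (if Q.Prime ∧ Q % 4 = 1 then
          (if Q'.Prime ∧ Q' % 4 = 1 then ((jacobiSym (Q : ℤ) Q' : ℤ) : ℂ) * rWS[h](Q * Q') else 0)
          else 0) = tS[h](a, m, b, n) := by
  rw [Finset.sum_filter]
  refine Finset.sum_congr rfl fun Q _ => ?_
  by_cases hQ : Q.Prime ∧ Q % 4 = 1
  · simp only [if_pos hQ, Finset.sum_filter]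
  · simp only [if_neg hQ, Finset.sum_const_zero]

/-- A filtered product sum as an iterated sum with indicator. -/
theorem sum_filter_product_eq (a a' b b' : ℕ) (F : ℕ × ℕ → ℂ) :
    ∑ q ∈ (Finset.Ioc a a' ×ˢ Finset.Ioc b b').filter
        (fun q : ℕ × ℕ => (q.1.Prime ∧ q.1 % 4 = 1) ∧ (q.2.Prime ∧ q.2 % 4 = 1)), F q =
      ∑ Q ∈ Finset.Ioc a a', ∑ Q' ∈ Finset.Ioc b b',
        if (Q.Prime ∧ Q % 4 = 1) ∧ (Q'.Prime ∧ Q' % 4 = 1) then F (Q, Q') else 0 := by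
  rw [Finset.sum_filter, Finset.sum_product]

/-! ### The cell bound -/

/-- **The bound for one cell.** See the module docstring. The weight is
`w(t) = c_k(t)/L^k` with `c_k` the cutoff coefficients (support in `[1, x]` when
`N + k(L-1) ≤ x`); `H ≥ 1` is the frequency cutoff (`2H < ab`), and `Bd` bounds the twisted sums
`T_h((a,m] × (b,n])` for `0 < |h| ≤ H`, `a ≤ m ≤ a'`, `b ≤ n ≤ b'`. -/
theorem cell_bound (x M N L k : ℕ) (hL : 0 < L) (hxw : N + k * (L - 1) ≤ x)
    (a a' b b' H : ℕ) (ha : 1 ≤ a) (haa' : a ≤ a') (ha2 : a' ≤ 2 * a) (hb : 1 ≤ b)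
    (hbb' : b ≤ b') (hb2 : b' ≤ 2 * b) (hH : 1 ≤ H) (hHab : 2 * H < a * b) (Bd : ℝ)
    (hTW : ∀ h : ℤ, h ≠ 0 → |h| ≤ H → ∀ m ∈ Finset.Icc a a', ∀ n ∈ Finset.Icc b b',
      ‖tS[h](a, m, b, n)‖ ≤ Bd) :
    |∑ q ∈ (Finset.Ioc a a' ×ˢ Finset.Ioc b b').filter
        (fun q : ℕ × ℕ => (q.1.Prime ∧ q.1 % 4 = 1) ∧ (q.2.Prime ∧ q.2 % 4 = 1)),
      (jacobiSym (q.1 : ℤ) q.2 : ℝ) *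
        ((∑ t ∈ (Finset.Icc 1 x).filter (fun t : ℕ => q.1 * q.2 ∣ t ^ 2 + 1),
            (((cutoffPoly[M, N, L, k]).coeff t : ℕ) : ℝ) / (L : ℝ) ^ k) -
          4 * (∑ t ∈ Finset.Icc 1 x, (((cutoffPoly[M, N, L, k]).coeff t : ℕ) : ℝ) / (L : ℝ) ^ k) /
            ((q.1 * q.2 : ℕ) : ℝ))| ≤
      2 * H * Bd * (4 * (∑ t ∈ Finset.Icc 1 x, (((cutoffPoly[M, N, L, k]).coeff t : ℕ) : ℝ) / (L : ℝ) ^ k) *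
          (1 + 3 * Real.pi * ((H : ℝ) * x) / ((a : ℝ) * b)) ^ 2 / ((a : ℝ) * b)) +
        ((Finset.Ioc a a' ×ˢ Finset.Ioc b b').filter
          (fun q : ℕ × ℕ => (q.1.Prime ∧ q.1 % 4 = 1) ∧ (q.2.Prime ∧ q.2 % 4 = 1))).card *
          (4 * (((a' : ℝ) * b') / (2 * H)) ^ (k + 1) / (L : ℝ) ^ k) := by
  -- the weight
  set w : ℕ → ℝ := fun t => (((cutoffPoly[M, N, L, k]).coeff t : ℕ) : ℝ) / (L : ℝ) ^ k with hw
  have hw0 : ∀ t, 0 ≤ w t := fun t => by rw [hw]; positivity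
  set W : ℝ := ∑ t ∈ Finset.Icc 1 x, w t with hW
  have hW0 : 0 ≤ W := Finset.sum_nonneg fun t _ => hw0 t
  set P := (Finset.Ioc a a' ×ˢ Finset.Ioc b b').filter
    (fun q : ℕ × ℕ => (q.1.Prime ∧ q.1 % 4 = 1) ∧ (q.2.Prime ∧ q.2 % 4 = 1)) with hP
  -- frequency ranges
  set Hin := (Finset.Icc (-(H : ℤ)) (H : ℤ)).filter (fun h : ℤ => h ≠ 0) with hHin
  set HH : ℕ → Finset ℤ := fun q =>
    (Finset.Icc (-((q / 2 : ℕ) : ℤ)) ((q / 2 : ℕ) : ℤ)).filter (fun h : ℤ => h ≠ 0) with hHH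
  -- basic facts about members of `P`
  have hmem : ∀ q ∈ P, a < q.1 ∧ q.1 ≤ a' ∧ b < q.2 ∧ q.2 ≤ b' ∧ q.1.Prime ∧ q.1 % 4 = 1 ∧
      q.2.Prime ∧ q.2 % 4 = 1 := by
    intro q hq
    rw [hP, Finset.mem_filter, Finset.mem_product, Finset.mem_Ioc, Finset.mem_Ioc] at hq
    exact ⟨hq.1.1.1, hq.1.1.2, hq.1.2.1, hq.1.2.2, hq.2.1.1, hq.2.1.2, hq.2.2.1, hq.2.2.2⟩
  have hab0 : 0 < a * b := Nat.mul_pos (by omega) (by omega)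
  have hqlow : ∀ q ∈ P, a * b < q.1 * q.2 := by
    intro q hq
    obtain ⟨h1, -, h3, -⟩ := hmem q hq
    exact Nat.mul_lt_mul'' h1 h3
  have hqup : ∀ q ∈ P, q.1 * q.2 ≤ a' * b' := by
    intro q hq
    obtain ⟨-, h2, -, h4, -⟩ := hmem q hq
    exact Nat.mul_le_mul h2 h4
  have hqodd : ∀ q ∈ P, (q.1 * q.2) % 2 = 1 := by
    intro q hq
    obtain ⟨-, -, -, -, -, h1, -, h2⟩ := hmem q hq
    have : (q.1 * q.2) % 4 = 1 := by rw [Nat.mul_mod, h1, h2]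
    omega
  have hHin_sub : ∀ q ∈ P, Hin ⊆ HH (q.1 * q.2) := by
    intro q hq
    have hlt := hqlow q hq
    have hH2 : (H : ℤ) ≤ ((q.1 * q.2 / 2 : ℕ) : ℤ) := by
      have : H ≤ q.1 * q.2 / 2 := by omega
      exact_mod_cast this
    intro h hh
    rw [hHin, Finset.mem_filter, Finset.mem_Icc] at hh
    rw [hHH, Finset.mem_filter, Finset.mem_Icc]
    exact ⟨⟨by omega, by omega⟩, hh.2⟩
  -- Step 1/2: move to `ℂ` and expand each term (pointwise Fourier expansion)
  have hcast : ∀ q ∈ P, (((jacobiSym (q.1 : ℤ) q.2 : ℝ) *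
      ((∑ t ∈ (Finset.Icc 1 x).filter (fun t : ℕ => q.1 * q.2 ∣ t ^ 2 + 1), w t) -
        4 * W / ((q.1 * q.2 : ℕ) : ℝ)) : ℝ) : ℂ) =
      ((jacobiSym (q.1 : ℤ) q.2 : ℤ) : ℂ) *
        ((∑ t ∈ (Finset.Icc 1 x).filter (fun t : ℕ => q.1 * q.2 ∣ t ^ 2 + 1), ((w t : ℝ) : ℂ)) -
          4 * (∑ t ∈ Finset.Icc 1 x, ((w t : ℝ) : ℂ)) / ((q.1 * q.2 : ℕ) : ℂ)) := by
    intro q _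
    rw [hW]
    push_cast
    ring
  have hexp : ∀ q ∈ P, (((jacobiSym (q.1 : ℤ) q.2 : ℝ) *
      ((∑ t ∈ (Finset.Icc 1 x).filter (fun t : ℕ => q.1 * q.2 ∣ t ^ 2 + 1), w t) -
        4 * W / ((q.1 * q.2 : ℕ) : ℝ)) : ℝ) : ℂ) =
      ((jacobiSym (q.1 : ℤ) q.2 : ℤ) : ℂ) * ((1 / ((q.1 * q.2 : ℕ) : ℂ)) * ∑ h ∈ HH (q.1 * q.2),
        (∑ t ∈ Finset.Icc 1 x, ((w t : ℝ) : ℂ) *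
            Complex.exp (2 * Real.pi * Complex.I * (h : ℂ) * (t : ℂ) / ((q.1 * q.2 : ℕ) : ℂ))) *
          rWS[-h](q.1 * q.2)) := by
    intro q hq
    rw [hcast q hq]
    obtain ⟨-, -, -, -, hp1, h41, hp2, h42⟩ := hmem q hq
    by_cases heq : q.1 = q.2
    · have hJ : jacobiSym (q.1 : ℤ) q.2 = 0 := by rw [heq]; exact jacobiSym_self_prime hp2
      rw [hJ]; simp
    · congr 1
      have hF := sum_filter_dvd_sub_main_eq_fourier (q.1 * q.2) (hqodd q hq) (Finset.Icc 1 x)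
        (fun t => ((w t : ℝ) : ℂ))
      rw [card_roots_mul_eq_four hp1 hp2 h41 h42 heq] at hF
      rw [← hF]
      push_cast
      ring
  rw [← Real.norm_eq_abs, ← Complex.norm_real, Complex.ofReal_sum, Finset.sum_congr rfl hexp]
  -- Step 3: split the frequencies
  have hsplit : ∀ q ∈ P, ∑ h ∈ HH (q.1 * q.2),
      (∑ t ∈ Finset.Icc 1 x, ((w t : ℝ) : ℂ) *
          Complex.exp (2 * Real.pi * Complex.I * (h : ℂ) * (t : ℂ) / ((q.1 * q.2 : ℕ) : ℂ))) *
        rWS[-h](q.1 * q.2) =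
      ∑ h ∈ Hin, (∑ t ∈ Finset.Icc 1 x, ((w t : ℝ) : ℂ) *
          Complex.exp (2 * Real.pi * Complex.I * (h : ℂ) * (t : ℂ) / ((q.1 * q.2 : ℕ) : ℂ))) *
        rWS[-h](q.1 * q.2) +
      ∑ h ∈ HH (q.1 * q.2) \ Hin, (∑ t ∈ Finset.Icc 1 x, ((w t : ℝ) : ℂ) *
          Complex.exp (2 * Real.pi * Complex.I * (h : ℂ) * (t : ℂ) / ((q.1 * q.2 : ℕ) : ℂ))) *
        rWS[-h](q.1 * q.2) := by
    intro q hq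
    rw [← Finset.sum_sdiff (hHin_sub q hq), add_comm]
  have hsplit2 : ∀ q ∈ P, ((jacobiSym (q.1 : ℤ) q.2 : ℤ) : ℂ) * ((1 / ((q.1 * q.2 : ℕ) : ℂ)) *
      ∑ h ∈ HH (q.1 * q.2), (∑ t ∈ Finset.Icc 1 x, ((w t : ℝ) : ℂ) *
            Complex.exp (2 * Real.pi * Complex.I * (h : ℂ) * (t : ℂ) / ((q.1 * q.2 : ℕ) : ℂ))) *
          rWS[-h](q.1 * q.2)) =
      ∑ h ∈ Hin, (((jacobiSym (q.1 : ℤ) q.2 : ℤ) : ℂ) * rWS[-h](q.1 * q.2)) *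
        Gw[w, x, h](q.1 * q.2) +
      ((jacobiSym (q.1 : ℤ) q.2 : ℤ) : ℂ) * ((1 / ((q.1 * q.2 : ℕ) : ℂ)) *
        ∑ h ∈ HH (q.1 * q.2) \ Hin, (∑ t ∈ Finset.Icc 1 x, ((w t : ℝ) : ℂ) *
            Complex.exp (2 * Real.pi * Complex.I * (h : ℂ) * (t : ℂ) / ((q.1 * q.2 : ℕ) : ℂ))) *
          rWS[-h](q.1 * q.2)) := by
    intro q hq
    rw [hsplit q hq, mul_add, mul_add, Finset.mul_sum, Finset.mul_sum]
    congr 1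
    refine Finset.sum_congr rfl fun h _ => ?_
    ring
  rw [Finset.sum_congr rfl hsplit2, Finset.sum_add_distrib]
  refine (norm_add_le _ _).trans (add_le_add ?_ ?_)
  · -- Step 4: the frequencies `0 < |h| ≤ H`
    rw [Finset.sum_comm]
    have hBd0 : 0 ≤ Bd := (norm_nonneg _).trans (hTW 1 one_ne_zero (by simp; exact_mod_cast hH) a
      (Finset.mem_Icc.mpr ⟨le_rfl, haa'⟩) b (Finset.mem_Icc.mpr ⟨le_rfl, hbb'⟩))
    have hY : ∀ h ∈ Hin, ‖∑ q ∈ P, (((jacobiSym (q.1 : ℤ) q.2 : ℤ) : ℂ) * rWS[-h](q.1 * q.2)) *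
        Gw[w, x, h](q.1 * q.2)‖ ≤ Bd * (4 * W * (1 + 3 * Real.pi * ((H : ℝ) * x) / ((a : ℝ) * b)) ^ 2 /
          ((a : ℝ) * b)) := by
      intro h hh
      rw [hHin, Finset.mem_filter, Finset.mem_Icc] at hh
      have hh0 : h ≠ 0 := hh.2
      have hhH : |h| ≤ H := abs_le.mpr hh.1
      -- to an iterated sum over the rectangle
      rw [hP, sum_filter_product_eq]
      have hker : ∀ Q ∈ Finset.Ioc a a', ∀ Q' ∈ Finset.Ioc b b',
          (if (Q.Prime ∧ Q % 4 = 1) ∧ (Q'.Prime ∧ Q' % 4 = 1) then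
            (((jacobiSym ((Q, Q').1 : ℤ) (Q, Q').2 : ℤ) : ℂ) * rWS[-h]((Q, Q').1 * (Q, Q').2)) *
              Gw[w, x, h]((Q, Q').1 * (Q, Q').2) else 0) =
          (if Q.Prime ∧ Q % 4 = 1 then
            (if Q'.Prime ∧ Q' % 4 = 1 then ((jacobiSym (Q : ℤ) Q' : ℤ) : ℂ) * rWS[-h](Q * Q') else 0)
            else 0) * Gw[w, x, h](Q * Q') := by
        intro Q _ Q' _
        simp only [ite_and, ite_mul, zero_mul]
      rw [Finset.sum_congr rfl fun Q hQ => Finset.sum_congr rfl fun Q' hQ' => hker Q hQ Q' hQ']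
      have hAbel := norm_sum_sum_mul_le_abel2
        (fun Q Q' => if Q.Prime ∧ Q % 4 = 1 then
          (if Q'.Prime ∧ Q' % 4 = 1 then ((jacobiSym (Q : ℤ) Q' : ℤ) : ℂ) * rWS[-h](Q * Q') else 0)
          else 0)
        (fun Q Q' => Gw[w, x, h](Q * Q')) haa' hbb' (B := Bd) (by
          intro m hm n hn
          rw [sum_Ioc_Ioc_kernel_eq]
          exact hTW (-h) (neg_ne_zero.mpr hh0) (by rw [abs_neg]; exact hhH) m hm n hn)
      refine hAbel.trans (mul_le_mul_of_nonneg_left ?_ hBd0)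
      refine (variation_G_le w hw0 x h ha hb haa' ha2 hbb' hb2).trans ?_
      rw [← hW]
      have hhR : |(h : ℝ)| ≤ H := by
        rw [← Int.cast_abs]; exact_mod_cast hhH
      have hnum : (1 + 3 * Real.pi * (|(h : ℝ)| * x) / ((a : ℝ) * b)) ^ 2 ≤
          (1 + 3 * Real.pi * ((H : ℝ) * x) / ((a : ℝ) * b)) ^ 2 := by
        have h0 : 0 ≤ 1 + 3 * Real.pi * (|(h : ℝ)| * x) / ((a : ℝ) * b) := by positivity
        refine pow_le_pow_left₀ h0 ?_ 2
        gcongr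
      exact div_le_div_of_nonneg_right (mul_le_mul_of_nonneg_left hnum (by positivity))
        (by positivity)
    refine (norm_sum_le _ _).trans ((Finset.sum_le_sum hY).trans ?_)
    rw [Finset.sum_const, card_Icc_filter_ne_zero, nsmul_eq_mul]
    push_cast
    rw [hW]
    nlinarith [le_refl (2 * (H : ℝ) * Bd)]
  · -- Step 5: the tail `|h| > H`
    have htail : ∀ q ∈ P, ‖((jacobiSym (q.1 : ℤ) q.2 : ℤ) : ℂ) * ((1 / ((q.1 * q.2 : ℕ) : ℂ)) *
        ∑ h ∈ HH (q.1 * q.2) \ Hin, (∑ t ∈ Finset.Icc 1 x, ((w t : ℝ) : ℂ) *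
            Complex.exp (2 * Real.pi * Complex.I * (h : ℂ) * (t : ℂ) / ((q.1 * q.2 : ℕ) : ℂ))) *
          rWS[-h](q.1 * q.2))‖ ≤ 4 * (((a' : ℝ) * b') / (2 * H)) ^ (k + 1) / (L : ℝ) ^ k := by
      intro q hq
      obtain ⟨-, -, -, -, hp1, h41, hp2, h42⟩ := hmem q hq
      by_cases heq : q.1 = q.2
      · have hJ : jacobiSym (q.1 : ℤ) q.2 = 0 := by rw [heq]; exact jacobiSym_self_prime hp2
        rw [hJ]; simp; positivity
      set q₀ : ℕ := q.1 * q.2 with hq₀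
      have hq₀pos : 0 < q₀ := (Nat.zero_le _).trans_lt (hqlow q hq)
      have hq₀R : (0 : ℝ) < q₀ := by exact_mod_cast hq₀pos
      have hq₀C : ‖((q₀ : ℕ) : ℂ)‖ = q₀ := by simp
      -- each term of the tail
      have hterm : ∀ h ∈ HH q₀ \ Hin, ‖(∑ t ∈ Finset.Icc 1 x, ((w t : ℝ) : ℂ) *
            Complex.exp (2 * Real.pi * Complex.I * (h : ℂ) * (t : ℂ) / ((q₀ : ℕ) : ℂ))) *
          rWS[-h](q₀)‖ ≤ ((q₀ : ℝ) / (2 * H)) ^ (k + 1) / (L : ℝ) ^ k * 4 := by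
        intro h hh
        rw [Finset.mem_sdiff] at hh
        obtain ⟨hh0, hhq⟩ := two_mul_abs_le_of_mem hh.1
        have hhH : (H : ℝ) < |(h : ℝ)| := by
          have : ¬ (|h| ≤ H) := by
            intro hle
            apply hh.2
            rw [hHin, Finset.mem_filter, Finset.mem_Icc]
            exact ⟨abs_le.mp hle, hh0⟩
          push Not at this
          rw [← Int.cast_abs]
          exact_mod_cast this
        rw [norm_mul]
        refine mul_le_mul ?_ ?_ (norm_nonneg _) (by positivity)
        · have hdec := norm_cutoff_fourier_le M N L k x hL hxw q₀ h hh0 hhq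
          have hwC : ∀ t : ℕ, ((w t : ℝ) : ℂ) =
              ((((cutoffPoly[M, N, L, k]).coeff t : ℕ) : ℂ) / (L : ℂ) ^ k) := by
            intro t; rw [hw]; push_cast; ring
          simp_rw [hwC]
          refine hdec.trans ?_
          refine div_le_div_of_nonneg_right ?_ (by positivity)
          refine pow_le_pow_left₀ (by positivity) ?_ (k + 1)
          exact div_le_div_of_nonneg_left hq₀R.le (by positivity) (by linarith)
        · rw [hq₀]
          exact norm_rootWeylSum_mul_le_four hp1 hp2 h41 h42 heq (-h)
      have hcardHH : ((HH q₀ \ Hin).card : ℝ) ≤ q₀ := by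
        have h1 : (HH q₀ \ Hin).card ≤ (HH q₀).card := Finset.card_le_card Finset.sdiff_subset
        have h2 : (HH q₀).card ≤ (Finset.Icc (-((q₀ / 2 : ℕ) : ℤ)) ((q₀ / 2 : ℕ) : ℤ)).card :=
          Finset.card_filter_le _ _
        rw [Int.card_Icc] at h2
        have h3 : ((q₀ / 2 : ℕ) : ℤ) + 1 - -((q₀ / 2 : ℕ) : ℤ) = ((2 * (q₀ / 2) + 1 : ℕ) : ℤ) := by
          push_cast; ring
        rw [h3, Int.toNat_natCast] at h2
        have h4 : 2 * (q₀ / 2) + 1 ≤ q₀ := by have := hqodd q hq; omega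
        exact_mod_cast h1.trans (h2.trans h4)
      rw [norm_mul, norm_mul, norm_div, norm_one, hq₀C]
      calc ‖((jacobiSym (q.1 : ℤ) q.2 : ℤ) : ℂ)‖ * (1 / (q₀ : ℝ) * ‖∑ h ∈ HH q₀ \ Hin,
            (∑ t ∈ Finset.Icc 1 x, ((w t : ℝ) : ℂ) *
              Complex.exp (2 * Real.pi * Complex.I * (h : ℂ) * (t : ℂ) / ((q₀ : ℕ) : ℂ))) *
            rWS[-h](q₀)‖)
          ≤ 1 * (1 / (q₀ : ℝ) * (((HH q₀ \ Hin).card : ℝ) *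
              (((q₀ : ℝ) / (2 * H)) ^ (k + 1) / (L : ℝ) ^ k * 4))) := by
            refine mul_le_mul (norm_jacobiSym_le_one _ _) ?_ (by positivity) zero_le_one
            refine mul_le_mul_of_nonneg_left ?_ (by positivity)
            refine (norm_sum_le _ _).trans ?_
            refine (Finset.sum_le_sum hterm).trans ?_
            rw [Finset.sum_const, nsmul_eq_mul]
        _ ≤ 1 * (1 / (q₀ : ℝ) * ((q₀ : ℝ) *
              ((((a' : ℝ) * b') / (2 * H)) ^ (k + 1) / (L : ℝ) ^ k * 4))) := by
            refine mul_le_mul_of_nonneg_left (mul_le_mul_of_nonneg_left ?_ (by positivity)) zero_le_one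
            refine mul_le_mul hcardHH ?_ (by positivity) (by positivity)
            refine mul_le_mul_of_nonneg_right (div_le_div_of_nonneg_right
              (pow_le_pow_left₀ (by positivity) (div_le_div_of_nonneg_right ?_ (by positivity)) _)
                (by positivity)) (by norm_num)
            exact_mod_cast hqup q hq
        _ = 4 * (((a' : ℝ) * b') / (2 * H)) ^ (k + 1) / (L : ℝ) ^ k := by
            field_simp
    refine (norm_sum_le _ _).trans ((Finset.sum_le_sum htail).trans ?_)
    rw [Finset.sum_const, nsmul_eq_mul]

end Summit.Parity.BatemanHorn.Cruxes.SplitBlockJacobi.CofactorRootDiscrepancy.Poisson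

namespace Summit.Parity.BatemanHorn.Cruxes.SplitBlockJacobi.CofactorRootDiscrepancy

/-- **Registered stub form** of `Poisson.cell_bound`: the identical statement, declared in the crux
namespace under the name registered on stmt-Parity-11583 (`ledger workitem stub-add`). -/
theorem cell_bound :
    ∀ (x M N L k : ℕ) (hL : 0 < L) (hxw : N + k * (L - 1) ≤ x) (a a' b b' H : ℕ) (ha : 1 ≤ a) (haa' : a ≤ a') (ha2 : a' ≤ 2 * a) (hb : 1 ≤ b) (hbb' : b ≤ b') (hb2 : b' ≤ 2 * b) (hH : 1 ≤ H) (hHab : 2 * H < a * b) (Bd : ℝ) (hTW : ∀ h : ℤ, h ≠ 0 → |h| ≤ H → ∀ m ∈ Finset.Icc a a', ∀ n ∈ Finset.Icc b b', ‖(∑ Q ∈ (Finset.Ioc (a : ℕ) m).filter (fun Q : ℕ => Q.Prime ∧ Q % 4 = 1), ∑ Q' ∈ (Finset.Ioc (b : ℕ) n).filter (fun Q' : ℕ => Q'.Prime ∧ Q' % 4 = 1), ((jacobiSym (Q : ℤ) Q' : ℤ) : ℂ) * (∑ ν ∈ (Finset.range (Q * Q' : ℕ)).filter (fun ν : ℕ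 => (Q * Q' : ℕ) ∣ ν ^ 2 + 1), Complex.exp (2 * Real.pi * Complex.I * ((h : ℤ) : ℂ) * ((ν : ℕ) : ℂ) / ((Q * Q' : ℕ) : ℂ))))‖ ≤ Bd), |∑ q ∈ (Finset.Ioc a a' ×ˢ Finset.Ioc b b').filter (fun q : ℕ × ℕ => (q.1.Prime ∧ q.1 % 4 = 1) ∧ (q.2.Prime ∧ q.2 % 4 = 1)), (jacobiSym (q.1 : ℤ) q.2 : ℝ) * ((∑ t ∈ (Finset.Icc 1 x).filter (fun t : ℕ => q.1 * q.2 ∣ t ^ 2 + 1), (((((∑ s ∈ Finset.Ioc M N, (Polynomial.X : Polynomial ℕ) ^ s) * (∑ j ∈ Finset.range L, (Polynomial.X : Polynomial ℕ) ^ j) ^ k)).coeff t : ℕ) : ℝ) / (L : ℝ) ^ k) - 4 * (∑ t ∈ Finset.Icc 1 x, (((((∑ s ∈ Finset.Ioc M N, (Polynomial.X : Polynomial ℕ) ^ s) * (∑ j ∈ Finset.range L, (Polynomial.X : Polynomial ℕ) ^ j) ^ k)).coeff t : ℕ) : ℝ) / (L : ℝ) ^ k) / ((q.1 * q.2 : ℕ)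 : ℝ))| ≤ 2 * H * Bd * (4 * (∑ t ∈ Finset.Icc 1 x, (((((∑ s ∈ Finset.Ioc M N, (Polynomial.X : Polynomial ℕ) ^ s) * (∑ j ∈ Finset.range L, (Polynomial.X : Polynomial ℕ) ^ j) ^ k)).coeff t : ℕ) : ℝ) / (L : ℝ) ^ k) * (1 + 3 * Real.pi * ((H : ℝ) * x) / ((a : ℝ) * b)) ^ 2 / ((a : ℝ) * b)) + ((Finset.Ioc a a' ×ˢ Finset.Ioc b b').filter (fun q : ℕ × ℕ => (q.1.Prime ∧ q.1 % 4 = 1) ∧ (q.2.Prime ∧ q.2 % 4 = 1))).card * (4 * (((a' : ℝ) * b') / (2 * H)) ^ (k + 1) / (L : ℝ) ^ k) :=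
  @Poisson.cell_bound

end Summit.Parity.BatemanHorn.Cruxes.SplitBlockJacobi.CofactorRootDiscrepancy

end
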